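import Summits.RiemannHypothesis.RiemannHypothesis.Theorems.HandoffTranslatePair
import Summits.RiemannHypothesis.RiemannHypothesis.Theorems.HandoffCapacity
import Mathlib.Analysis.Calculus.BumpFunction.Basic
import HarnessLib

/-!
# HANDOFF — the PARITY of a collar pair's gain: the translate SUM, and why the sketch's `CollarPairGain` is false (cell rh-explicit, TRACK «HANDOFF», seat prove-2, ATTEMPT-14 §1 in the kernel)

HONEST FRAMING. Nothing here bears on the truth of RH. Companion of `HandoffTranslatePair.lean` (the DIFFERENCE of translates
`θ(· − c) − θ(· + c)` has contribution `+w_q‖θ‖₂²`, `w_q = 2 log q/√q`, `c = (log q)/2`). Here the SUM of translates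
`θ(· − c) + θ(· + c)` is shown to have kernel `2k_θ + k_θ(· − 2c) + k_θ(· + 2c)` and contribution `−w_q‖θ‖₂²` (the place `q` LOWERS
its energy), and the consequence for idea-3's PART G14 sketch (`HOME/handoff/idea-3/g14/HandoffCapacityUVFloorWitness.lean`,
`CollarPairGain`): the antisymmetric collar pair `g(x) = θ(x − c) − θ(−x − c)` is the translate DIFFERENCE when `θ` is even
(gain `+w_q‖θ‖₂²`, `HandoffCapacityUVFloor.placeGain_collarPair_of_even`) but the translate SUM when `θ` is ODD
(`placeGain_collarPair_of_odd`: gain `−w_q‖θ‖₂²`), so the sketch's unqualified `CollarPairGain q δ` — «gain `= w_q‖θ‖₂²` for every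
real `θ` supported in `[−δ, δ]`» — is FALSE for every prime `q` and every admissible `δ` (`not_collarPairGain`, witness `x·ψ(x)` with `ψ`
a bump of radius `δ`). The UV floor itself is unaffected (it is proved with the translate difference). NO definitions.

References (as printed): E. Bombieri, Rend. Mat. Acc. Lincei (9) 11 (2000) Thm 2, §4 Lemma 2 [`Bombieri2000Weil`]; A. Connes, C. Consani,
Enseign. Math. 69 (2023) §2.2–2.3 (the contribution of one prime, of either sign) [`ConnesConsani2023`].
-/

set_option linter.dupNamespace false

noncomputable section

open Complex Filter Set MeasureTheory Metric Literature.NumberTheory.LFunctions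
open Summit.RiemannHypothesis.RiemannHypothesis.Theorems.HandoffCapacity
open scoped Real Topology ComplexConjugate ContDiff

namespace Summit.RiemannHypothesis.RiemannHypothesis.Theorems.Handoff

variable {θ : ℝ → ℂ} {q : ℕ} {δ c : ℝ}

/-! ## §1 The translate sum -/

/-- The translate sum is a Weil test function. [folklore] -/
theorem isWeilTest_translateSum (hθ : IsWeilTest θ) (c : ℝ) :
    IsWeilTest fun x ↦ θ (x - c) + θ (x + c) :=
  ⟨(isWeilTest_comp_sub hθ c).1.add (isWeilTest_recentre hθ c).1,
    (isWeilTest_comp_sub hθ c).2.add (isWeilTest_recentre hθ c).2⟩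

/-- Support of the translate sum: `⊆ [−(c + δ), c + δ]` (for `tsupport θ ⊆ [−δ, δ]`, `0 ≤ c`). [folklore] -/
theorem tsupport_translateSum_subset (hθs : tsupport θ ⊆ Icc (-δ) δ) (hc : 0 ≤ c) :
    tsupport (fun x ↦ θ (x - c) + θ (x + c)) ⊆ Icc (-(c + δ)) (c + δ) := by
  have h1 : tsupport (fun x ↦ θ (x - c)) ⊆ Icc (-δ + c) (δ + c) := tsupport_comp_sub_subset hθs c
  have h2 : tsupport (fun x ↦ θ (x + c)) ⊆ Icc (-δ + -c) (δ + -c) := by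
    have := tsupport_comp_sub_subset hθs (-c)
    simpa only [sub_neg_eq_add] using this
  have e : (fun x ↦ θ (x - c) + θ (x + c)) = (fun x ↦ θ (x - c)) + fun x ↦ θ (x + c) := rfl
  rw [e]
  refine (tsupport_add _ _).trans (union_subset (h1.trans ?_) (h2.trans ?_))
  · exact Icc_subset_Icc (by linarith) (by linarith)
  · exact Icc_subset_Icc (by linarith) (by linarith)

/-- **The kernel of the translate sum**: `k_S = 2k_θ + k_θ(· − 2c) + k_θ(· + 2c)`. [folklore] -/
theorem weilConv_weilReflect_translateSum (hθ : IsWeilTest θ) (c : ℝ) :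
    weilConv (fun x ↦ θ (x - c) + θ (x + c)) (weilReflect fun x ↦ θ (x - c) + θ (x + c)) =
      fun y ↦ 2 * weilConv θ (weilReflect θ) y + weilConv θ (weilReflect θ) (y - 2 * c) +
        weilConv θ (weilReflect θ) (y + 2 * c) := by
  set u : ℝ → ℂ := fun x ↦ θ (x - c) with hu_def
  set v : ℝ → ℂ := fun x ↦ θ (x - (-c)) with hv_def
  have hu : IsWeilTest u := isWeilTest_comp_sub hθ c
  have hv : IsWeilTest v := isWeilTest_comp_sub hθ (-c)
  have hS : (fun x ↦ θ (x - c) + θ (x + c)) = u + v := by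
    funext x
    simp only [hu_def, hv_def, Pi.add_apply, sub_neg_eq_add]
  have kuu : weilConv u (weilReflect u) = weilConv θ (weilReflect θ) := weilConv_weilReflect_translate θ c
  have kvv : weilConv v (weilReflect v) = weilConv θ (weilReflect θ) := weilConv_weilReflect_translate θ (-c)
  have kuv : weilConv u (weilReflect v) = fun y ↦ weilConv θ (weilReflect θ) (y - 2 * c) := by
    rw [hu_def, hv_def, weilConv_translate_weilReflect_translate]
    funext y; ring_nf
  have kvu : weilConv v (weilReflect u) = fun y ↦ weilConv θ (weilReflect θ) (y + 2 * c) := by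
    rw [hu_def, hv_def, weilConv_translate_weilReflect_translate]
    funext y; ring_nf
  rw [hS, weilConv_weilReflect_add hu hv, kuu, kvv, kuv, kvu]
  funext y
  simp only [Pi.add_apply]
  ring

/-- **The contribution of `q` at the translate SUM is `−w_q‖θ‖₂²`** (`q` prime, `0 < δ < 1/(2(q+1))`, `tsupport θ ⊆ [−δ, δ]`,
`c = (log q)/2`): inserting the place `q` LOWERS the energy of two in-phase copies at distance `log q`. [cite: ConnesConsani2023, §2.2–2.3 (contribution of either sign); this track ATTEMPT-14 §1] -/
theorem contribution_translateSum (hq : q.Prime) (hθ : IsWeilTest θ) (hδ : 0 < δ)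
    (hδq : δ < 1 / (2 * ((q : ℝ) + 1))) (hθs : tsupport θ ⊆ Icc (-δ) δ) :
    contribution q (fun x ↦ θ (x - Real.log q / 2) + θ (x + Real.log q / 2)) =
      -(2 * Real.log q / Real.sqrt q) * ∫ x : ℝ, ‖θ x‖ ^ 2 := by
  obtain ⟨h2δ, -, -⟩ := translatePair_aux hq hδ hδq
  obtain ⟨-, ⟨hL, hL'⟩, ⟨h2L, h2L'⟩⟩ := translate_log_vanish (k := weilConv θ (weilReflect θ)) hq.two_le h2δ
    (fun s hs ↦ weilConv_weilReflect_eq_zero_of_lt_abs hθ hθs hs)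
  unfold contribution
  rw [weilConv_weilReflect_translateSum hθ (Real.log q / 2)]
  simp only
  rw [mul_div_cancel₀ _ (two_ne_zero' ℝ), sub_self, ← two_mul, neg_add_cancel, hL, hL', h2L,
    show -Real.log q - Real.log q = -(2 * Real.log q) by ring, h2L', weilConv_weilReflect_apply_zero]
  rw [show (2 * (0 : ℂ) + ((∫ t : ℝ, ‖θ t‖ ^ 2 : ℝ) : ℂ) + 0 + (2 * 0 + 0 + ((∫ t : ℝ, ‖θ t‖ ^ 2 : ℝ) : ℂ))) =
    ((2 * ∫ t : ℝ, ‖θ t‖ ^ 2 : ℝ) : ℂ) by push_cast; ring, Complex.ofReal_re]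
  ring

/-! ## §2 The antisymmetric collar pair of an ODD profile is the translate sum -/

/-- **Odd profile ⟹ the sketch's collar pair has gain `−w_q‖θ‖₂²`**: for `θ` odd, `θ(−x − c) = −θ(x + c)`, so
`θ(x − c) − θ(−x − c) = θ(x − c) + θ(x + c)` and `placeGain_q = contribution_q = −(2 log q/√q)‖θ‖₂²`. [this track, ATTEMPT-14 §1] -/
theorem placeGain_collarPair_of_odd (hq : q.Prime) (hθ : IsWeilTest θ) (hδ : 0 < δ)
    (hδq : δ < 1 / (2 * ((q : ℝ) + 1))) (hθs : tsupport θ ⊆ Icc (-δ) δ) (hodd : ∀ x, θ (-x) = -θ x) :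
    placeGain q (fun x ↦ θ (x - Real.log q / 2) - θ (-x - Real.log q / 2)) =
      -(2 * Real.log q / Real.sqrt q) * ∫ t : ℝ, ‖θ t‖ ^ 2 := by
  obtain ⟨-, -, hδc⟩ := translatePair_aux hq hδ hδq
  have e : (fun x ↦ θ (x - Real.log q / 2) - θ (-x - Real.log q / 2)) =
      fun x ↦ θ (x - Real.log q / 2) + θ (x + Real.log q / 2) := by
    funext x; rw [show -x - Real.log q / 2 = -(x + Real.log q / 2) by ring, hodd, sub_neg_eq_add]
  have hc0 : 0 ≤ Real.log q / 2 := by linarith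
  rw [e, placeGain_eq_contribution hq (isWeilTest_translateSum hθ _) (t := Real.log q / 2 + δ) (by linarith)
      (tsupport_translateSum_subset hθs hc0), contribution_translateSum hq hθ hδ hδq hθs]

/-- An odd, real-valued, non-zero Weil test function on every window `[−δ, δ]`, `δ > 0`: `x·ψ(x)` with `ψ` a bump of outer
radius `δ`. [folklore] -/
theorem exists_odd_real_isWeilTest (hδ : 0 < δ) :
    ∃ θ : ℝ → ℂ, IsWeilTest θ ∧ tsupport θ ⊆ Icc (-δ) δ ∧ (∀ x, (θ x).im = 0) ∧ (∀ x, θ (-x) = -θ x) ∧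
      0 < ∫ t : ℝ, ‖θ t‖ ^ 2 := by
  let ψ : ContDiffBump (0 : ℝ) := ⟨δ / 2, δ, by linarith, by linarith⟩
  set θ : ℝ → ℂ := fun x ↦ ((x * ψ x : ℝ) : ℂ) with hθ_def
  have hθ : IsWeilTest θ :=
    ⟨Complex.ofRealCLM.contDiff.comp (contDiff_id.mul ψ.contDiff),
      (ψ.hasCompactSupport.mul_left (f := fun x : ℝ ↦ x)).comp_left Complex.ofReal_zero⟩
  refine ⟨θ, hθ, ?_, fun x ↦ by simp [hθ_def], fun x ↦ ?_, ?_⟩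
  · intro x hx
    have h1 : x ∈ tsupport (fun y : ℝ ↦ y * ψ y) := by
      have hsub : Function.support θ ⊆ Function.support fun y : ℝ ↦ y * ψ y := by
        intro y hy; simpa [hθ_def, Function.mem_support] using hy
      exact closure_mono hsub hx
    have h2 : tsupport (fun y : ℝ ↦ y * ψ y) ⊆ tsupport (ψ : ℝ → ℝ) :=
      tsupport_mul_subset_right (f := fun y : ℝ ↦ y) (g := (ψ : ℝ → ℝ))
    have h3 := h2 h1
    rw [ψ.tsupport_eq, mem_closedBall, dist_zero_right, Real.norm_eq_abs] at h3
    exact ⟨by linarith [neg_abs_le x], by linarith [le_abs_self x]⟩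
  · simp only [hθ_def]
    push_cast
    rw [ψ.neg]
    ring
  · rw [integral_pos_iff_support_of_nonneg (fun t ↦ by positivity) hθ.integrable_norm_sq]
    have hsub : Ioo (0 : ℝ) δ ⊆ Function.support fun t : ℝ ↦ ‖θ t‖ ^ 2 := by
      intro t ht
      have hψ : 0 < ψ t :=
        ψ.pos_of_mem_ball (by rw [mem_ball, dist_zero_right, Real.norm_eq_abs, abs_of_pos ht.1]; exact ht.2)
      rw [Function.mem_support, hθ_def]
      simp only [Complex.norm_real, Real.norm_eq_abs]
      have : 0 < |t * ψ t| := abs_pos.2 (mul_ne_zero ht.1.ne' hψ.ne')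
      positivity
    calc (0 : ENNReal) < volume (Ioo (0 : ℝ) δ) := by rw [Real.volume_Ioo]; simpa using hδ
      _ ≤ volume (Function.support fun t : ℝ ↦ ‖θ t‖ ^ 2) := measure_mono hsub

/-- **The sketch's `CollarPairGain q δ` is false** for every prime `q` and every `0 < δ < 1/(2(q+1))`: there is a real-valued Weil
test function `θ` supported in `[−δ, δ]` whose antisymmetric collar pair has gain `−w_q‖θ‖₂² ≠ +w_q‖θ‖₂²` (any odd one).
The statement negated is `HOME/handoff/idea-3/g14/HandoffCapacityUVFloorWitness.lean`'s `CollarPairGain q δ` with `atomWeight q`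
written out as `2 log q/√q`. [this track, ATTEMPT-14 §1] -/
theorem not_collarPairGain (hq : q.Prime) (hδ : 0 < δ) (hδq : δ < 1 / (2 * ((q : ℝ) + 1))) :
    ¬ ∀ θ : ℝ → ℂ, IsWeilTest θ → tsupport θ ⊆ Icc (-δ) δ → (∀ x, (θ x).im = 0) →
      placeGain q (fun x ↦ θ (x - Real.log q / 2) - θ (-x - Real.log q / 2)) =
        2 * Real.log q / Real.sqrt q * ∫ t : ℝ, ‖θ t‖ ^ 2 := by
  intro h
  obtain ⟨θ, hθ, hθs, hre, hodd, hpos⟩ := exists_odd_real_isWeilTest hδ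
  have h1 := h θ hθ hθs hre
  rw [placeGain_collarPair_of_odd hq hθ hδ hδq hθs hodd] at h1
  have hw : 0 < 2 * Real.log q / Real.sqrt q := by
    have hlog : 0 < Real.log q := Real.log_pos (by exact_mod_cast hq.one_lt)
    have hsq : 0 < Real.sqrt q := Real.sqrt_pos.mpr (by exact_mod_cast hq.pos)
    positivity
  nlinarith [mul_pos hw hpos]

end Summit.RiemannHypothesis.RiemannHypothesis.Theorems.Handoff

end
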